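import Summits.BirchSwinnertonDyer.Rank1Residual.ManinAdditive.MinusOneLevelRaising
import Summits.BirchSwinnertonDyer.Rank1Residual.ManinAdditive.CuspidalKummerUFamily
import Literature.NumberTheory.EllipticCurves.ManinConstantModularDegree
import Literature.NumberTheory.EllipticCurves.QuadraticTwistJInvariantProofs
import Literature.NumberTheory.EllipticCurves.IsogenyQuadraticTwistProofs
import HarnessLib
import HarnessLib.Audit.Tags

/-!
# The `u`-family CURVE predicate `y² = (x+u)(x²+4)` (model-free), S-an-64 `UFamilyConductorLaw` and E-an-150
# `UFamilyOddDegreeAtFour` (an g32 §12, MEMO-an §75.11; TURNKEY-an-26 — statement part, landed first so that the width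
# provers can discharge S-an-64 by name: p3 g12 TAKING `uFamilyConductorLaw_holds`, STATUS 04:50:29Z)

TYPER NOTE (typer g17).  The definitions and the two curve lemmas of the `### Application` section of an's
HOME/an/g32/MinusOneLevelRaisingCNSTransportProof.lean sha16 966314cf4216aa25 VERBATIM, separated from the ČNS-transport
proofs (which wait for the farm build of B5a/B5c) into this dependency-light statement leaf; the assembled THEOREM
`uFamily_two_not_dvd_c_of_odd` lands with the transport file `MinusOneLevelRaisingCNSTransportProof.lean`, which imports this
one.  Decls: def `IsUFamilyCurve W u` (`W` is `ℚ`-isomorphic to the `u`-family model `(u, s)`; model-free form of the tree's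
`CuspidalKummer.IsUFamilyModel` p690768 with `u` exposed) + `isUFamilyCurve_of_isUFamilyModel`, `isUFamilyCurve_quadraticTwist_negOne`
(`W ⊗ (−1)` is a `(−u)`-family curve); **S-an-64 `UFamilyConductorLaw`** (untagged per an: a finite symbolic computation —
Tate's algorithm on the explicit family; `u ≡ 1 (4) ⇒ 4 ∥ N(W)`, `u ≡ 3 (4) ⇒ N(W) = 4·N(W ⊗ χ₋₄)`; census 55 + 31 optimal
totally-blind classes `≤ 5·10⁵`); **E-an-150 `UFamilyOddDegreeAtFour`** (census LAW, 55/55 odd modular degree at `4 ∥ N`) —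
tagged `@[conjecture]` by the typer like every E-row (an's file has it untagged; nothing asserted either way).  REFUTER: R-an-61
text-mode BC7 CLEAN ×2 (an S64_probe.txt 3dd5a1401ddf9bfe); by-name after landing.  bears_on: stmt-BirchSwinnertonDyer-22967 (C2),
the odd-`u` half of E-an-50R `CuspidalKummer.UFamilyManinOdd`.  BSD is not proved by this; Manin's conjecture is not proved by this.
-/

open scoped MatrixGroups ModularForm
open CongruenceSubgroup WeierstrassCurve
  Literature.NumberTheory.DiophantineGeometry
  Literature.NumberTheory.EllipticCurves
  Literature.NumberTheory.EllipticCurves.ModularForms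

namespace Summit.BirchSwinnertonDyer.Rank1Residual.ManinAdditive

section UFamily

/-- `W` is `ℚ`-isomorphic to the `u`-family model `(u, s)` for some translation `s` (model-free form of the
tree's `CuspidalKummer.IsUFamilyModel`, with the parameter `u` exposed; `u` is an invariant of the curve). -/
def IsUFamilyCurve (W : WeierstrassCurve ℚ) (u : ℤ) : Prop :=
  ∃ (C : VariableChange ℚ) (s : ℤ), (C • W).a₁ = 0 ∧ (C • W).a₃ = 0 ∧ (C • W).a₂ = (3 * s + u : ℤ) ∧
    (C • W).a₄ = (3 * s ^ 2 + 2 * s * u + 4 : ℤ) ∧ (C • W).a₆ = ((s + u) * (s ^ 2 + 4) : ℤ)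

/-- A `u`-family MODEL (tree `CuspidalKummer.IsUFamilyModel`, E-an-50♯) is a `u`-family curve (`C = 1`). -/
theorem isUFamilyCurve_of_isUFamilyModel {W : WeierstrassCurve ℚ} (h : CuspidalKummer.IsUFamilyModel W) :
    ∃ u : ℤ, IsUFamilyCurve W u := by
  obtain ⟨u, s, h₁, h₃, h₂, h₄, h₆⟩ := h
  exact ⟨u, 1, s, by simpa using h₁, by simpa using h₃, by simpa using h₂, by simpa using h₄, by simpa using h₆⟩

/-- The `χ₋₄`-twist of the `u`-family model `(u, s)` IS the model `(−u, −s)`: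
`−[(−x+s+u)((−x+s)²+4)] = (x−s−u)((x−s)²+4)`. -/
theorem isUFamilyCurve_quadraticTwist_negOne {W : WeierstrassCurve ℚ} {u : ℤ} (h : IsUFamilyCurve W u) :
    IsUFamilyCurve (W.quadraticTwist ((-1 : ℤ) : ℚ)) (-u) := by
  obtain ⟨C, s, h₁, h₃, h₂, h₄, h₆⟩ := h
  -- twist the normal-form model `C • W` and transport along `quadraticTwist_smul`
  have key := quadraticTwist_smul (W := W) C ((-1 : ℤ) : ℚ)
  refine ⟨⟨C.u, ((-1 : ℤ) : ℚ) * C.r, 0, 0⟩, -s, ?_⟩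
  rw [← key]
  refine ⟨rfl, rfl, ?_, ?_, ?_⟩
  · rw [quadraticTwist_a₂, WeierstrassCurve.b₂, h₁, h₂]; push_cast; ring
  · rw [quadraticTwist_a₄, WeierstrassCurve.b₄, h₁, h₃, h₄]; push_cast; ring
  · rw [quadraticTwist_a₆, WeierstrassCurve.b₆, h₃, h₆]; push_cast; ring

/-- **Candidate S-an-64 `UFamilyConductorLaw`** (Tate's algorithm on the explicit family; census: every optimal
totally-blind class `≤ 5·10⁵` — `u ≡ 1 (4)`: 55 classes at `N = 4(u²+4)′` (Kodaira IV*), `u ≡ 3 (4)`: 31 classes at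
`16 ∣ N` with `χ₋₄`-partner at `N/4` (I₀*)).  Odd `u` only; `u ≡ 1 (mod 4)` ⟹ `4 ∥ N(W)`; `u ≡ 3 (mod 4)` ⟹
`N(W) = 4 · N(W ⊗ χ₋₄)`.  A finite symbolic computation (typing target for -ty / p2, Barrios-port style). -/
def UFamilyConductorLaw : Prop :=
  ∀ (W : WeierstrassCurve ℚ) [W.IsElliptic] (u : ℤ), IsUFamilyCurve W u →
    (u % 4 = 1 → 2 ^ 2 ∣ W.conductorNorm ℤ ∧ ¬ 2 ^ 3 ∣ W.conductorNorm ℤ) ∧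
    (u % 4 = 3 → (haveI := W.isElliptic_quadraticTwist (show ((-1 : ℤ) : ℚ) ≠ 0 by norm_num);
      4 * (W.quadraticTwist ((-1 : ℤ) : ℚ)).conductorNorm ℤ) = W.conductorNorm ℤ)

/-- **Candidate E-an-150 `UFamilyOddDegreeAtFour`** (census LAW: 55/55 optimal `u`-family classes with `4 ∥ N`,
`N < 5·10⁵`, have ODD modular degree — 1, 3, 15, 21, 123, 153, 345, 831, 1185, 2067, …; equivalently `v₂(deg) = 2`
for all 31 partners at `16(u²+4)′`).  Why it might fail: an optimal `u`-family curve of even degree at `4 ∥ N`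
beyond the tables (Watkins: `2^{rank} ∣ deg`; all census members have odd degree). -/
@[conjecture]
def UFamilyOddDegreeAtFour : Prop :=
  ∀ (W : WeierstrassCurve ℚ) [W.IsElliptic] [W.IsGloballyMinimal] [NeZero (W.conductorNorm ℤ)]
    (D : ModularParametrizationData W (W.conductorNorm ℤ)) (u : ℤ),
    IsLatticeOptimal D → IsUFamilyCurve W u → u % 4 = 1 → ¬ 2 ∣ D.modularDegree

end UFamily

end Summit.BirchSwinnertonDyer.Rank1Residual.ManinAdditive
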